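import Literature.Analysis.DeBrangesSpaces.BurnolTrigPolynomialVanishing
import Mathlib.Analysis.SpecialFunctions.Pow.Asymptotics
import HarnessLib

/-!
# Burnol 2001 (CRAS 333), §1, proof of Thm. 1.5: elimination of the dominant singularities

Burnol (TeX l.409–416): a finite combination of the vectors `X^λ_{w,k}`, whose singular parts at
`t → 0⁺` are `(log 1/t)^k t^{−w}`, can be regular at the origin only if "il n'y a aucune contribution
d'un couple `(k,w)` avec `Re(w) > 1/2`" — the terms are eliminated layer by layer, most singular
first.  In the variable `x = log(1/t) → +∞` the singular parts are `x^k e^{(σ + iτ)x}`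
(`w = σ + iτ`), and the abstract statement proved here (`eq_zero_of_sum_pow_mul_exp_eq`) is:

  if `Σ_{(σ,τ,k) ∈ P} c_{σ,τ,k} x^k e^{σx} e^{iτx} = R(x)` for all large `x`, with all `σ > 0` and a
  remainder `R` of sub-exponential growth (`e^{−θx}R(x) → 0` for every `θ > 0`), then all `c = 0`.

Proof: strong induction on `P`; divide by the dominant `x^{k*}e^{σ* x}`; the top layer becomes a
trigonometric polynomial tending to `0`, hence vanishes (`eq_zero_of_tendsto_trigPoly_atTop`).
RH-FREE.  Brick 4b of the proof of `Burnol2001CRAS_thm1_5C`.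

## References
* [Burnol2001CRAS] J.-F. Burnol, C. R. Acad. Sci. Paris 333 (2001) 201–206, §1, proof of Thm. 1.5
  (TeX l.409–416).
-/

open Filter Complex Finset
open scoped Real Topology

namespace Literature.Analysis.DeBrangesSpaces

namespace Burnol2001

/-- `‖e^{iτx}‖ = 1`. [folklore] -/
private theorem norm_cexp_I_mul_real' (τ x : ℝ) : ‖cexp (I * τ * x)‖ = 1 := by
  rw [show (I * τ * x : ℂ) = ((τ * x : ℝ) : ℂ) * I by push_cast; ring, Complex.norm_exp_ofReal_mul_I]

/-- The weight `x^{−k} e^{−σx}` kills a sub-exponential remainder. [folklore] -/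
private theorem tendsto_weight_mul_remainder {R : ℝ → ℂ}
    (hR : ∀ θ : ℝ, 0 < θ → Tendsto (fun x : ℝ ↦ Real.exp (-(θ * x)) * ‖R x‖) atTop (𝓝 0))
    {σ : ℝ} (hσ : 0 < σ) (k : ℕ) :
    Tendsto (fun x : ℝ ↦ ((x ^ (-(k : ℝ)) * Real.exp (-(σ * x)) : ℝ) : ℂ) * R x) atTop (𝓝 0) := by
  refine squeeze_zero_norm' ?_ (hR σ hσ)
  filter_upwards [eventually_ge_atTop (1 : ℝ)] with x hx
  rw [norm_mul, Complex.norm_real, Real.norm_eq_abs, abs_mul, abs_of_nonneg (Real.exp_nonneg _),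
    abs_of_nonneg (Real.rpow_nonneg (by linarith) _)]
  have h1 : x ^ (-(k : ℝ)) ≤ 1 := Real.rpow_le_one_of_one_le_of_nonpos hx (by simp)
  calc x ^ (-(k : ℝ)) * Real.exp (-(σ * x)) * ‖R x‖ ≤ 1 * Real.exp (-(σ * x)) * ‖R x‖ := by
        gcongr
    _ = Real.exp (-(σ * x)) * ‖R x‖ := by rw [one_mul]

/-- A lower term dies under the dominant weight: `x^{k−k*} e^{(σ−σ*)x} → 0` when `σ < σ*`, or
`σ = σ*` and `k < k*`. [folklore] -/
private theorem tendsto_weight_mul_term {σ σ' : ℝ} {k k' : ℕ} (h : σ < σ' ∨ (σ = σ' ∧ k < k'))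
    (a : ℂ) (τ : ℝ) :
    Tendsto (fun x : ℝ ↦ ((x ^ (-(k' : ℝ)) * Real.exp (-(σ' * x)) : ℝ) : ℂ) *
      (a * (((Real.exp (σ * x) * x ^ k : ℝ)) : ℂ) * cexp (I * τ * x))) atTop (𝓝 0) := by
  -- the real scalar factor tends to `0`
  have hreal : Tendsto (fun x : ℝ ↦ x ^ ((k : ℝ) - k') * Real.exp (-((σ' - σ) * x))) atTop (𝓝 0) := by
    rcases h with h | ⟨rfl, hk⟩
    · have := tendsto_rpow_mul_exp_neg_mul_atTop_nhds_zero ((k : ℝ) - k') (σ' - σ) (by linarith)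
      exact this.congr' (Eventually.of_forall fun x ↦ by rw [neg_mul])
    · have hk' : (0 : ℝ) < (k' : ℝ) - k := by exact_mod_cast (show (0 : ℤ) < k' - k by omega)
      have := tendsto_rpow_neg_atTop hk'
      refine this.congr' ?_
      filter_upwards with x
      rw [sub_self, zero_mul, neg_zero, Real.exp_zero, mul_one, neg_sub]
  have hnorm : Tendsto (fun x : ℝ ↦ ‖a‖ * (x ^ ((k : ℝ) - k') * Real.exp (-((σ' - σ) * x)))) atTop
      (𝓝 0) := by
    have := hreal.const_mul ‖a‖
    rwa [mul_zero] at this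
  refine squeeze_zero_norm' ?_ hnorm
  filter_upwards [eventually_gt_atTop (0 : ℝ)] with x hx
  apply le_of_eq
  rw [norm_mul, norm_mul, norm_mul, norm_cexp_I_mul_real', mul_one, Complex.norm_real,
    Complex.norm_real, Real.norm_eq_abs, Real.norm_eq_abs,
    abs_of_nonneg (mul_nonneg (Real.rpow_nonneg hx.le _) (Real.exp_nonneg _)),
    abs_of_nonneg (mul_nonneg (Real.exp_nonneg _) (pow_nonneg hx.le _)),
    ← Real.rpow_natCast x k, Real.rpow_sub hx, Real.rpow_neg hx.le,
    show -((σ' - σ) * x) = -(σ' * x) + σ * x by ring, Real.exp_add]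
  have hxk : x ^ (k' : ℝ) ≠ 0 := (Real.rpow_pos_of_pos hx _).ne'
  field_simp

/-- **Elimination of the dominant singularities (Burnol 2001, proof of Thm. 1.5), abstract form.**
Let `P` be a finite set of triples `(σ, τ, k)` with `σ > 0` and `c : P → ℂ`.  If, for all large `x`,
`Σ_{(σ,τ,k)∈P} c (e^{σx} x^k) e^{iτx} = R(x)` with `e^{−θx}‖R(x)‖ → 0` for every `θ > 0`, then all
`c = 0` (in `t = e^{−x}`: a combination of `(log 1/t)^k t^{−w}`, `Re w > 0`, which is `O(t^{−ε})` for
every `ε > 0` near `0⁺` is trivial). [cite: Burnol2001CRAS, §1, proof of Théorème 1.5 (TeX l.409–416)] -/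
theorem eq_zero_of_sum_pow_mul_exp_eq (P : Finset (ℝ × ℝ × ℕ)) (hσ : ∀ p ∈ P, 0 < p.1)
    (c : ℝ × ℝ × ℕ → ℂ) {R : ℝ → ℂ}
    (hR : ∀ θ : ℝ, 0 < θ → Tendsto (fun x : ℝ ↦ Real.exp (-(θ * x)) * ‖R x‖) atTop (𝓝 0))
    (heq : ∀ᶠ x : ℝ in atTop, ∑ p ∈ P, c p * (((Real.exp (p.1 * x) * x ^ p.2.2 : ℝ)) : ℂ) *
      cexp (I * p.2.1 * x) = R x) :
    ∀ p ∈ P, c p = 0 := by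
  classical
  induction P using Finset.strongInductionOn with
  | _ P ih =>
  rcases P.eq_empty_or_nonempty with hP | hP
  · simp [hP]
  -- the dominant layer: `σ* = max σ`, `k* = max k on {σ = σ*}`, `Top = {σ = σ*, k = k*}`
  obtain ⟨p₁, hp₁, hmax₁⟩ := P.exists_max_image (fun p ↦ p.1) hP
  set σs : ℝ := p₁.1 with hσs
  have hLne : (P.filter fun p ↦ p.1 = σs).Nonempty := ⟨p₁, mem_filter.2 ⟨hp₁, rfl⟩⟩
  obtain ⟨p₂, hp₂, hmax₂⟩ := (P.filter fun p ↦ p.1 = σs).exists_max_image (fun p ↦ p.2.2) hLne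
  set ks : ℕ := p₂.2.2 with hks
  have hp₂P : p₂ ∈ P := (mem_filter.1 hp₂).1
  have hp₂σ : p₂.1 = σs := (mem_filter.1 hp₂).2
  set Top : Finset (ℝ × ℝ × ℕ) := P.filter (fun p ↦ p.1 = σs ∧ p.2.2 = ks) with hTop
  have hmemTop : ∀ p, p ∈ Top ↔ p ∈ P ∧ (p.1 = σs ∧ p.2.2 = ks) := fun p ↦ by rw [hTop, mem_filter]
  have hTopP : Top ⊆ P := filter_subset _ _
  have hTopne : Top.Nonempty := ⟨p₂, (hmemTop p₂).2 ⟨hp₂P, hp₂σ, rfl⟩⟩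
  have hσs0 : 0 < σs := by rw [hσs]; exact hσ p₁ hp₁
  -- order facts
  have hord : ∀ p ∈ P, p ∉ Top → p.1 < σs ∨ (p.1 = σs ∧ p.2.2 < ks) := by
    intro p hp hpT
    have h1 : p.1 ≤ σs := hmax₁ p hp
    rcases h1.lt_or_eq with h1 | h1
    · exact Or.inl h1
    · right
      refine ⟨h1, ?_⟩
      have h2 : p.2.2 ≤ ks := hmax₂ p (mem_filter.2 ⟨hp, h1⟩)
      rcases h2.lt_or_eq with h2 | h2
      · exact h2
      · exact absurd ((hmemTop p).2 ⟨hp, h1, h2⟩) hpT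
  -- (A) the top layer is a trigonometric polynomial tending to `0`
  set w : ℝ → ℂ := fun x ↦ (((x ^ (-(ks : ℝ)) * Real.exp (-(σs * x)) : ℝ)) : ℂ) with hw
  have hTlim : Tendsto (fun x : ℝ ↦ ∑ p ∈ Top, c p * cexp (I * p.2.1 * x)) atTop (𝓝 0) := by
    -- `T(x) = w(x)R(x) − Σ_{p ∉ Top} w(x) c_p term_p(x)` for `x > 0`
    have h1 : Tendsto (fun x : ℝ ↦ w x * R x -
        ∑ p ∈ P \ Top, w x * (c p * (((Real.exp (p.1 * x) * x ^ p.2.2 : ℝ)) : ℂ) *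
          cexp (I * p.2.1 * x))) atTop (𝓝 0) := by
      have hA := tendsto_weight_mul_remainder hR hσs0 ks
      have hB : Tendsto (fun x : ℝ ↦ ∑ p ∈ P \ Top, w x * (c p *
          (((Real.exp (p.1 * x) * x ^ p.2.2 : ℝ)) : ℂ) * cexp (I * p.2.1 * x))) atTop (𝓝 0) := by
        rw [show (0 : ℂ) = ∑ p ∈ P \ Top, (0 : ℂ) by simp]
        refine tendsto_finsetSum _ fun p hp ↦ ?_
        rw [Finset.mem_sdiff] at hp
        rw [hw]
        exact tendsto_weight_mul_term (hord p hp.1 hp.2) (c p) p.2.1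
      have := hA.sub hB
      rwa [sub_zero] at this
    refine h1.congr' ?_
    filter_upwards [heq, eventually_gt_atTop (0 : ℝ)] with x hx hx0
    -- `Σ_P = Σ_Top + Σ_{P \ Top}` and `w · Σ_Top-term = T`
    rw [← hx, ← sum_sdiff hTopP, mul_add, mul_sum, mul_sum, add_sub_cancel_left]
    refine sum_congr rfl fun p hp ↦ ?_
    have hpσ : p.1 = σs := ((hmemTop p).1 hp).2.1
    have hpk : p.2.2 = ks := ((hmemTop p).1 hp).2.2
    rw [hw]; dsimp only
    rw [hpσ, hpk]
    have e1 : (((x ^ (-(ks : ℝ)) * Real.exp (-(σs * x)) : ℝ)) : ℂ) *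
        (((Real.exp (σs * x) * x ^ ks : ℝ)) : ℂ) = 1 := by
      rw [← Complex.ofReal_mul, ← Complex.ofReal_one]
      congr 1
      rw [← Real.rpow_natCast x ks, Real.rpow_neg hx0.le, Real.exp_neg]
      have hxk' : x ^ (ks : ℝ) ≠ 0 := (Real.rpow_pos_of_pos hx0 _).ne'
      have hex : Real.exp (σs * x) ≠ 0 := (Real.exp_pos _).ne'
      field_simp
    calc (((x ^ (-(ks : ℝ)) * Real.exp (-(σs * x)) : ℝ)) : ℂ) *
          (c p * (((Real.exp (σs * x) * x ^ ks : ℝ)) : ℂ) * cexp (I * p.2.1 * x))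
        = c p * ((((x ^ (-(ks : ℝ)) * Real.exp (-(σs * x)) : ℝ)) : ℂ) *
            (((Real.exp (σs * x) * x ^ ks : ℝ)) : ℂ)) * cexp (I * p.2.1 * x) := by ring
      _ = c p * cexp (I * p.2.1 * x) := by rw [e1, mul_one]
  -- reindex the top layer by its frequencies and apply the trigonometric-polynomial lemma
  have hTop_eq : ∀ p ∈ Top, p = (σs, p.2.1, ks) := by
    intro p hp
    have h := ((hmemTop p).1 hp).2
    ext <;> simp [h.1, h.2]
  have hinj : Set.InjOn (fun p : ℝ × ℝ × ℕ ↦ p.2.1) Top := by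
    intro p hp q hq hpq
    rw [hTop_eq p hp, hTop_eq q hq]
    simp only at hpq
    rw [hpq]
  have hzeroTop : ∀ p ∈ Top, c p = 0 := by
    have hT' : Tendsto (fun x : ℝ ↦ ∑ τ ∈ Top.image (fun p ↦ p.2.1), c (σs, τ, ks) * cexp (I * τ * x))
        atTop (𝓝 0) := by
      refine hTlim.congr' (Eventually.of_forall fun x ↦ ?_)
      dsimp only
      rw [sum_image hinj]
      refine sum_congr rfl fun p hp ↦ ?_
      rw [← hTop_eq p hp]
    have h0 := eq_zero_of_tendsto_trigPoly_atTop _ _ hT'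
    intro p hp
    have := h0 p.2.1 (mem_image_of_mem _ hp)
    rwa [← hTop_eq p hp] at this
  -- (B) remove the top layer and use the induction hypothesis
  have hsub : P \ Top ⊂ P := sdiff_ssubset hTopP hTopne
  have hIH := ih (P \ Top) hsub (fun p hp ↦ hσ p (Finset.mem_sdiff.1 hp).1) ?_
  · intro p hp
    by_cases hpT : p ∈ Top
    · exact hzeroTop p hpT
    · exact hIH p (Finset.mem_sdiff.2 ⟨hp, hpT⟩)
  · filter_upwards [heq] with x hx
    rw [← hx, ← sum_sdiff hTopP]
    have : ∑ p ∈ Top, c p * (((Real.exp (p.1 * x) * x ^ p.2.2 : ℝ)) : ℂ) * cexp (I * p.2.1 * x) = 0 :=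
      sum_eq_zero fun p hp ↦ by rw [hzeroTop p hp, zero_mul, zero_mul]
    rw [this, add_zero]

/-! ## The `t → 0⁺` form: `Σ c_{w,k} (log t)^k t^{−w}`, `Re w > 0` -/

/-- `e^{−x} → 0⁺` as `x → +∞` (within `(0,∞)`). [folklore] -/
private theorem tendsto_exp_neg_nhdsGT_zero :
    Tendsto (fun x : ℝ ↦ Real.exp (-x)) atTop (𝓝[>] (0 : ℝ)) := by
  have h1 : Tendsto Real.exp atBot (𝓝[>] (0 : ℝ)) := by
    rw [← Real.map_exp_atBot]; exact tendsto_map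
  exact h1.comp tendsto_neg_atTop_atBot

/-- **Elimination of the dominant singularities, `t → 0⁺` form** (Burnol 2001, proof of Thm. 1.5,
TeX l.409–416: "Elle ne peut être [régulière] au voisinage de l'origine que si il n'y a aucune
contribution …").  Let `s` be a finite set of pairs `(w, k)` with `Re w > 0` and `c : s → ℂ`.  If
`Σ_{(w,k)∈s} c_{w,k} (log t)^k t^{−w} = E(t)` for `t → 0⁺` with `t^θ‖E(t)‖ → 0` for every `θ > 0`
(e.g. `E` bounded near `0`), then all `c_{w,k} = 0`.
[cite: Burnol2001CRAS, §1, proof of Théorème 1.5 (TeX l.409–416)] -/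
theorem eq_zero_of_sum_log_pow_mul_cpow_eq (s : Finset (ℂ × ℕ)) (hs : ∀ p ∈ s, 0 < p.1.re)
    (c : ℂ × ℕ → ℂ) {E : ℝ → ℂ}
    (hE : ∀ θ : ℝ, 0 < θ → Tendsto (fun t : ℝ ↦ t ^ θ * ‖E t‖) (𝓝[>] (0 : ℝ)) (𝓝 0))
    (heq : ∀ᶠ t : ℝ in 𝓝[>] (0 : ℝ), ∑ p ∈ s, c p * ((Real.log t : ℝ) : ℂ) ^ p.2 *
      ((t : ℝ) : ℂ) ^ (-p.1) = E t) :
    ∀ p ∈ s, c p = 0 := by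
  classical
  -- reindex by `(σ, τ, k) = (Re w, Im w, k)` and substitute `t = e^{−x}`
  set g : ℂ × ℕ → ℝ × ℝ × ℕ := fun p ↦ (p.1.re, p.1.im, p.2) with hg
  have hginj : Set.InjOn g s := by
    intro p _ q _ hpq
    simp only [hg, Prod.mk.injEq] at hpq
    exact Prod.ext (Complex.ext hpq.1 hpq.2.1) hpq.2.2
  set c' : ℝ × ℝ × ℕ → ℂ := fun q ↦ (-1) ^ q.2.2 * c (⟨q.1, q.2.1⟩, q.2.2) with hc'
  have hc'g : ∀ p, c' (g p) = (-1) ^ p.2 * c p := by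
    intro p
    simp only [hc', hg, Complex.eta, Prod.mk.eta]
  have hσ : ∀ q ∈ s.image g, 0 < q.1 := by
    intro q hq
    obtain ⟨p, hp, rfl⟩ := mem_image.1 hq
    exact hs p hp
  have hR : ∀ θ : ℝ, 0 < θ → Tendsto (fun x : ℝ ↦ Real.exp (-(θ * x)) * ‖E (Real.exp (-x))‖)
      atTop (𝓝 0) := by
    intro θ hθ
    refine ((hE θ hθ).comp tendsto_exp_neg_nhdsGT_zero).congr fun x ↦ ?_
    simp only [Function.comp_apply]
    rw [← Real.exp_mul, show -x * θ = -(θ * x) by ring]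
  have heq' : ∀ᶠ x : ℝ in atTop, ∑ q ∈ s.image g, c' q *
      (((Real.exp (q.1 * x) * x ^ q.2.2 : ℝ)) : ℂ) * cexp (I * q.2.1 * x) = E (Real.exp (-x)) := by
    filter_upwards [tendsto_exp_neg_nhdsGT_zero.eventually heq] with x hx
    rw [← hx, sum_image hginj]
    refine sum_congr rfl fun p _ ↦ ?_
    rw [hc'g]
    simp only [hg]
    have h1 : ((Real.exp (-x) : ℝ) : ℂ) ^ (-p.1) = ((Real.exp (p.1.re * x) : ℝ) : ℂ) *
        cexp (I * p.1.im * x) := by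
      rw [cpow_def_of_ne_zero (ofReal_ne_zero.2 (Real.exp_pos _).ne'),
        ← Complex.ofReal_log (Real.exp_pos _).le, Real.log_exp, Complex.ofReal_exp, ← Complex.exp_add]
      congr 1
      conv_lhs => rw [← Complex.re_add_im p.1]
      push_cast
      ring
    rw [Real.log_exp, h1]
    push_cast
    ring
  have h0 := eq_zero_of_sum_pow_mul_exp_eq (s.image g) hσ c' hR heq'
  intro p hp
  have := h0 (g p) (mem_image_of_mem g hp)
  rw [hc'g] at this
  exact (mul_eq_zero.1 this).resolve_left (pow_ne_zero _ (by norm_num))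

end Burnol2001

end Literature.Analysis.DeBrangesSpaces
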